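import Mathlib.MeasureTheory.Measure.Haar.DistribChar
import Mathlib.Analysis.SpecialFunctions.Pow.NNReal
import Literature.NumberTheory.Automorphic.QuaternionAlgebraAdelic

/-!
# Fujisaki's compactness theorem for the adelic units of a division quaternion algebra

Companion ("proofs") file of `QuaternionAlgebraAdelic`, working towards a proof of the named fact
`AdelicGroupData.compactSpace_automorphicQuotient_units` (Fujisaki's lemma: for a division
quaternion algebra `D` over a number field `K` the automorphic quotient
`(D ⊗ 𝔸_K)ˣ ⧸ (ℝ_{>0} · Dˣ)` is compact; Vignéras, LNM 800, Ch. III §1 Thm. 1.4 (Idèles 3) and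
Exercice 1.1; Weil, *Basic Number Theory*, Ch. IV §3 Thm. 4).

The printed proofs (Weil IV §3, p. 74; Vignéras III §1) rest on four classical inputs which
Mathlib (at the pinned revision) does not provide and which are vendored here as named facts:

* `compactSpace_adicCompletionIntegers K` — the integer rings `𝒪_v` of the completions `K_v` are
  compact (so `𝔸_K`, hence `D_𝔸 = 𝔸_K ⊗_K D`, is locally compact and carries Haar measures);
* `discreteTopology_rationalLattice K D`, `compactSpace_quotient_rationalLattice K D` — Weil's
  Thm. IV.2 = Vignéras III Thm. 1.4 (Adèles 1): `D` is discrete and cocompact in `D_𝔸`;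
* `addHaar_units_smul_eq_op_smul K D` — for central simple `D`, left and right multiplication by
  an adelic unit have the same module (Vignéras II §4 "module commun"; Weil IX §2 Prop. 6 Cor. 1);
* `addHaar_posRealCentral_smul K D` — the module of the diagonal real scalar `t > 0` on `D_𝔸` is
  `t ^ ([K:ℚ] · dim_K D)` (Vignéras II §4, III §1; Weil IV §4).

What is *proved* here:

* topology of `R ⊗[K] D` with its module topology: coordinates `≃ₜ R^n`
  (`ScalarExtension.coordHomeomorph`), Hausdorffness, local compactness, Borel structure; `𝔸_K` is
  Hausdorff, and locally compact granted `compactSpace_adicCompletionIntegers`;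
* `exists_ne_sub_mem_of_measure_lt` — Blichfeldt's principle for a *covering* set (Weil II §4
  Lemma 1, "the Minkowski argument"), and `exists_isCompact_image_mk_eq_univ`;
* the left and right modules `leftModule`, `rightModule` of adelic units (Mathlib
  `distribHaarChar`) and their basic properties;
* **`exists_isCompact_mul_inclAdelic_mem` — Fujisaki's lemma in Weil's form (BNT Thm. IV.4)**:
  for a finite-dimensional division algebra `D`, granted Thm. IV.2 for `D`, the set
  `{x ∈ D_𝔸ˣ : ‖x‖ₗ ≤ m, ‖x‖ᵣ ≥ m⁻¹}` is contained in `Y · Dˣ` for a compact `Y ⊆ D_𝔸ˣ`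
  (Weil's proof, verbatim);
* **`AdelicGroupData.compactSpace_automorphicQuotient_units_of`** — the target fact follows from
  the four inputs (rescale by `ℝ_{>0}` to module `1`, apply Thm. IV.4 with `m = 1`).

Remaining (later sessions, bottom-up): prove the four inputs, then
`AdelicGroupData.compactSpace_automorphicQuotient_units_holds`.

## References

* A. Weil, *Basic Number Theory* (1967), Ch. II §4 Lemma 1; Ch. IV §2 Thm. 2, §3 Prop. 3 and
  Thm. 4 (p. 74, "the proof ... is the one due to G. Fujisaki"), §4 Thm. 5; Ch. IX §2 Prop. 6 Cor. 1.
* M.-F. Vignéras, *Arithmétique des algèbres de quaternions*, LNM 800 (1980), Ch. II §4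
  (modules), Ch. III §1 Théorème fondamental 1.4 and Exercice 1.1.
* G. Fujisaki, *On the zeta-functions of the simple algebra over the field of rational numbers*,
  J. Fac. Sci. Univ. Tokyo Sect. I 7 (1958), 567–604.
-/

noncomputable section

open scoped TensorProduct NNReal Pointwise ENNReal RestrictedProduct
open NumberField IsDedekindDomain MeasureTheory Topology

universe u

namespace Literature.NumberTheory.Automorphic

/-! ### Topology of `R ⊗[K] D`: coordinates, Hausdorffness, local compactness, Borel structure -/

namespace ScalarExtension

section Coordinates

variable (K : Type*) [Field K] (R : Type*) [CommRing R] [Algebra K R] [TopologicalSpace R]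
  (D : Type*) [Ring D] [Algebra K D]

/-- The Borel σ-algebra on `R ⊗[K] D` (module topology). [folklore] -/
instance instMeasurableSpace : MeasurableSpace (ScalarExtension K R D) := borel _

/-- `R ⊗[K] D` is a Borel space by definition of its σ-algebra. [folklore] -/
instance instBorelSpace : BorelSpace (ScalarExtension K R D) := ⟨rfl⟩

variable [IsTopologicalRing R] [Module.Finite K D]

/-- Coordinates: the `R`-linear isomorphism `R ⊗[K] D ≃ R^n`, `n = dim_K D`, given by base-changing
the basis `Module.finBasis K D` of `D` (Mathlib `Algebra.TensorProduct.basis`, `Basis.equivFun`);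
Weil, BNT Ch. IV §1 (`𝒜_A ≅ k_A^n` by a choice of basis). [folklore] -/
def coordLinearEquiv :
    ScalarExtension K R D ≃ₗ[R] (Fin (Module.finrank K D) → R) :=
  (Algebra.TensorProduct.basis R (Module.finBasis K D)).equivFun

/-- The coordinate isomorphism `R ⊗[K] D ≃ R^n` is a homeomorphism for the module topology on the
left and the product topology on the right (both are module topologies, and linear maps out of a
module topology are continuous: Mathlib `IsModuleTopology.continuous_of_linearMap`). [folklore] -/
def coordHomeomorph :
    ScalarExtension K R D ≃ₜ (Fin (Module.finrank K D) → R) where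
  toEquiv := (coordLinearEquiv K R D).toEquiv
  continuous_toFun :=
    IsModuleTopology.continuous_of_linearMap (coordLinearEquiv K R D).toLinearMap
  continuous_invFun := by
    haveI : ContinuousAdd (ScalarExtension K R D) := IsModuleTopology.toContinuousAdd R _
    exact IsModuleTopology.continuous_of_linearMap (coordLinearEquiv K R D).symm.toLinearMap

/-- `coordHomeomorph` is the coordinate map (definitional). [folklore] -/
@[simp]
theorem coordHomeomorph_apply (x : ScalarExtension K R D) :
    coordHomeomorph K R D x = coordLinearEquiv K R D x := rfl

/-- `R ⊗[K] D` is Hausdorff when `R` is (it is homeomorphic to `R^n`). [folklore] -/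
instance instT2Space [T2Space R] : T2Space (ScalarExtension K R D) :=
  (coordHomeomorph K R D).isEmbedding.t2Space

/-- `R ⊗[K] D` is locally compact when `R` is (it is homeomorphic to `R^n`); Weil, BNT Ch. IV §1
("`𝒜_A` is locally compact"). [folklore] -/
instance instLocallyCompactSpace [LocallyCompactSpace R] :
    LocallyCompactSpace (ScalarExtension K R D) :=
  (coordHomeomorph K R D).isClosedEmbedding.locallyCompactSpace

/-- `R ⊗[K] D` is a topological additive group (module topology, `D` finite). [folklore] -/
instance instIsTopologicalAddGroup : IsTopologicalAddGroup (ScalarExtension K R D) :=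
  inferInstance

end Coordinates

end ScalarExtension

/-! ### The adele ring: Hausdorffness and local compactness -/

section AdeleRing

variable (K : Type) [Field K] [NumberField K]

omit [NumberField K] in
/-- The infinite adele ring `K_∞ = ∏_{v ∣ ∞} K_v` is Hausdorff (finite product of normed fields). [folklore] -/
theorem t2Space_infiniteAdeleRing : T2Space (InfiniteAdeleRing K) :=
  inferInstanceAs (T2Space ((v : InfinitePlace K) → v.Completion))

/-- The finite adele ring `𝔸_K^∞ = ∏'_v K_v` is Hausdorff (restricted product of valued fields,
Mathlib `RestrictedProduct` instance). [folklore] -/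
theorem t2Space_finiteAdeleRing : T2Space (FiniteAdeleRing (𝓞 K) K) :=
  inferInstanceAs (T2Space (Πʳ v : HeightOneSpectrum (𝓞 K),
    [v.adicCompletion K, v.adicCompletionIntegers K]))

/-- The adele ring `𝔸_K = K_∞ × 𝔸_K^∞` is Hausdorff. [folklore] -/
theorem t2Space_adeleRing : T2Space (AdeleRing (𝓞 K) K) := by
  haveI := t2Space_infiniteAdeleRing K
  haveI := t2Space_finiteAdeleRing K
  exact inferInstanceAs (T2Space (InfiniteAdeleRing K × FiniteAdeleRing (𝓞 K) K))

/-- **Compactness of the local rings of integers**: for every finite place `v` of the number field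
`K` the valuation ring `𝒪_v ⊆ K_v` of the `v`-adic completion is compact (`K_v` is a local field,
i.e. a non-discrete locally compact field, and `𝒪_v` is its maximal compact subring). Mathlib (at
the pinned revision) has `K_v`, `𝒪_v`, that `𝒪_v` is a complete DVR, and the criterion
`Valued.integer.compactSpace_iff_completeSpace_and_isDiscreteValuationRing_and_finite_residueField`,
but not the finiteness of the residue field of `𝒪_v`; hence a named fact.
[cite: WeilBNT1967, Ch. III §1 Def. 2 (completions of an A-field are local fields) with Ch. I §4 (the maximal compact subring of a p-field)] -/
def compactSpace_adicCompletionIntegers : Prop :=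
  ∀ v : HeightOneSpectrum (𝓞 K), CompactSpace (v.adicCompletionIntegers K)

/-- The finite adele ring is locally compact, granted compactness of all `𝒪_v` (Mathlib's
`RestrictedProduct` instance: restricted product of locally compact groups with respect to compact
open subgroups; Weil, BNT Ch. IV §1). [folklore] -/
theorem locallyCompactSpace_finiteAdeleRing (h : compactSpace_adicCompletionIntegers K) :
    LocallyCompactSpace (FiniteAdeleRing (𝓞 K) K) := by
  haveI : ∀ v : HeightOneSpectrum (𝓞 K), CompactSpace (v.adicCompletionIntegers K) := h
  haveI : Fact (∀ v : HeightOneSpectrum (𝓞 K),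
      IsOpen (v.adicCompletionIntegers K : Set (v.adicCompletion K))) :=
    ⟨fun _ ↦ Valued.isOpen_valuationSubring _⟩
  exact inferInstanceAs (LocallyCompactSpace (Πʳ v : HeightOneSpectrum (𝓞 K),
    [v.adicCompletion K, v.adicCompletionIntegers K]))

/-- The adele ring `𝔸_K` is locally compact, granted compactness of all `𝒪_v` (`K_∞` is locally
compact in Mathlib: `InfiniteAdeleRing.locallyCompactSpace`; Weil, BNT Ch. IV §1). [folklore] -/
theorem QuaternionAlgebraAdelicProofs.locallyCompactSpace_adeleRing (h : compactSpace_adicCompletionIntegers K) :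
    LocallyCompactSpace (AdeleRing (𝓞 K) K) := by
  haveI := locallyCompactSpace_finiteAdeleRing K h
  exact inferInstanceAs (LocallyCompactSpace (InfiniteAdeleRing K × FiniteAdeleRing (𝓞 K) K))

end AdeleRing

/-! ### Two lemmas on locally compact groups -/

section Covering

/-- If `Γ ≤ G` is a subgroup of a weakly locally compact topological additive group with compact
quotient `G ⧸ Γ`, some compact `B ⊆ G` maps onto `G ⧸ Γ` (the quotient map is open; Weil, BNT
Ch. II §4, proof of Lemma 1). [folklore] -/
theorem exists_isCompact_image_mk_eq_univ {G : Type*} [AddGroup G] [TopologicalSpace G]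
    [IsTopologicalAddGroup G] [WeaklyLocallyCompactSpace G] (Γ : AddSubgroup G)
    [CompactSpace (G ⧸ Γ)] :
    ∃ B : Set G, IsCompact B ∧ (QuotientAddGroup.mk : G → G ⧸ Γ) '' B = Set.univ := by
  choose k hk hk' using fun x : G => exists_compact_mem_nhds x
  have hcov : (Set.univ : Set (G ⧸ Γ)) ⊆
      ⋃ x : G, (QuotientAddGroup.mk : G → G ⧸ Γ) '' interior (k x) := by
    rintro q -
    obtain ⟨x, rfl⟩ := QuotientAddGroup.mk_surjective q
    exact Set.mem_iUnion.2 ⟨x, x, mem_interior_iff_mem_nhds.2 (hk' x), rfl⟩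
  obtain ⟨t, ht⟩ := isCompact_univ.elim_finite_subcover _
    (fun x => QuotientAddGroup.isOpenMap_coe _ isOpen_interior) hcov
  refine ⟨⋃ x ∈ t, k x, t.isCompact_biUnion fun x _ => hk x, Set.eq_univ_of_forall fun q => ?_⟩
  obtain ⟨x, hx, hq⟩ : ∃ x ∈ t, q ∈ (QuotientAddGroup.mk : G → G ⧸ Γ) '' interior (k x) := by
    simpa only [Set.mem_iUnion, exists_prop] using ht (Set.mem_univ q)
  obtain ⟨y, hy, rfl⟩ := hq
  exact ⟨y, Set.mem_biUnion hx (interior_subset hy), rfl⟩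

/-- **Blichfeldt's principle** for a covering set: if `L` is a countable subgroup of the additive
group `E`, `B ⊆ E` is a measurable set with `L + B = E`, `μ` is a left-invariant measure and
`S` is a measurable set with `μ B < μ S`, then two distinct points of `S` differ by an element of
`L`. (Compared with Mathlib's `exists_pair_mem_lattice_not_disjoint_vadd`, `B` need only cover, not
be a fundamental domain.) Weil, BNT Ch. II §4 Lemma 1 ("the Minkowski argument"). [cite: WeilBNT1967, Ch. II §4 Lemma 1] -/
theorem exists_ne_sub_mem_of_measure_lt {E : Type*} [AddGroup E] [MeasurableSpace E]
    [MeasurableAdd E] (μ : Measure E) [μ.IsAddLeftInvariant] (L : AddSubgroup E) [Countable L]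
    {B S : Set E} (hB : MeasurableSet B) (hcov : ∀ x : E, ∃ g ∈ L, g + x ∈ B)
    (hS : MeasurableSet S) (h : μ B < μ S) :
    ∃ a ∈ S, ∃ b ∈ S, a ≠ b ∧ a - b ∈ L := by
  by_contra! H
  -- pieces of `B`: `T g = {b ∈ B | -g + b ∈ S}`
  set T : L → Set E := fun g => B ∩ (fun b => -(g : E) + b) ⁻¹' S with hT
  have hTm : ∀ g, MeasurableSet (T g) := fun g => hB.inter ((measurable_const_add _) hS)
  have hTd : Pairwise (Function.onFun Disjoint T) := by
    intro g g' hgg'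
    refine Set.disjoint_left.2 fun b hb hb' => ?_
    have hne : -(g : E) + b ≠ -(g' : E) + b := by
      intro heq
      exact hgg' (Subtype.ext (neg_injective (add_right_cancel heq)))
    refine H _ hb.2 _ hb'.2 hne ?_
    have : -(g : E) + b - (-(g' : E) + b) = ((-g + g' : L) : E) := by
      simp only [AddSubgroup.coe_add, AddSubgroup.coe_neg]
      rw [sub_eq_add_neg, neg_add_rev, neg_neg, add_assoc, add_neg_cancel_left]
    rw [this]
    exact SetLike.coe_mem _
  -- their translates cover `S`
  have hSsub : S ⊆ ⋃ g : L, (fun x => (g : E) + x) ⁻¹' T g := by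
    intro x hx
    obtain ⟨g, hg, hgx⟩ := hcov x
    refine Set.mem_iUnion.2 ⟨⟨g, hg⟩, hgx, ?_⟩
    simpa only [Set.mem_preimage, neg_add_cancel_left] using hx
  have h1 : μ S ≤ μ B :=
    calc μ S ≤ μ (⋃ g : L, (fun x => (g : E) + x) ⁻¹' T g) := measure_mono hSsub
      _ ≤ ∑' g : L, μ ((fun x => (g : E) + x) ⁻¹' T g) := measure_iUnion_le _
      _ = ∑' g : L, μ (T g) := by simp only [measure_preimage_add]
      _ = μ (⋃ g : L, T g) := (measure_iUnion hTd hTm).symm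
      _ ≤ μ B := measure_mono (Set.iUnion_subset fun g => Set.inter_subset_left)
  exact (not_le.2 h) h1

end Covering

/-! ### The lattice `D ⊆ D_𝔸` and Weil's Theorem IV.2 (Vignéras III, Thm. 1.4, Adèles 1) -/

section Lattice

variable (K : Type) [Field K] [NumberField K] (D : Type u) [Ring D] [Algebra K D]

/-- The image of the diagonal embedding `D → D_𝔸 = 𝔸_K ⊗_K D`, `x ↦ 1 ⊗ x`, as an additive
subgroup: the lattice `X_K ⊆ X_A` of Vignéras III §1 (Weil: `E ⊆ E_A`). [folklore] -/
def rationalLattice : AddSubgroup (ScalarExtension K (AdeleRing (𝓞 K) K) D) :=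
  (ScalarExtension.incl K (AdeleRing (𝓞 K) K) D).toRingHom.toAddMonoidHom.range

/-- Membership in the lattice `D ⊆ D_𝔸` (definitional). [folklore] -/
theorem mem_rationalLattice_iff {x : ScalarExtension K (AdeleRing (𝓞 K) K) D} :
    x ∈ rationalLattice K D ↔ ∃ d : D, ScalarExtension.incl K (AdeleRing (𝓞 K) K) D d = x :=
  Iff.rfl

/-- `incl d ∈ rationalLattice`. [folklore] -/
theorem incl_mem_rationalLattice (d : D) :
    ScalarExtension.incl K (AdeleRing (𝓞 K) K) D d ∈ rationalLattice K D := ⟨d, rfl⟩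

/-- **Weil, BNT Thm. IV.2 (discreteness)** = Vignéras III §1 Thm. 1.4, Adèles 1), first half:
for a finite-dimensional `K`-algebra (or vector space) `D` over a number field, `D` is discrete
in `D_𝔸 = 𝔸_K ⊗_K D`. [cite: WeilBNT1967, Ch. IV §2 Thm. 2] -/
def discreteTopology_rationalLattice : Prop :=
  ∀ [Module.Finite K D], DiscreteTopology (rationalLattice K D)

/-- **Weil, BNT Thm. IV.2 (cocompactness)** = Vignéras III §1 Thm. 1.4, Adèles 1), second half:
for a finite-dimensional `K`-algebra (or vector space) `D` over a number field, `D_𝔸 ⧸ D` is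
compact. [cite: WeilBNT1967, Ch. IV §2 Thm. 2] -/
def compactSpace_quotient_rationalLattice : Prop :=
  ∀ [Module.Finite K D], CompactSpace (ScalarExtension K (AdeleRing (𝓞 K) K) D ⧸ rationalLattice K D)

end Lattice

/-! ### Modules of adelic units (Vignéras II §4, III §1; Weil IV §3) -/

section Modules

variable (K : Type) [Field K] [NumberField K] (D : Type u) [Ring D] [Algebra K D]

/-- **Vignéras II §4 (module commun) / Weil IX.2 Prop. 6 Cor. 1 with IV.3 Prop. 3**: for a
central simple finite-dimensional `K`-algebra `D` and a unit `u` of `D_𝔸 = 𝔸_K ⊗_K D`, left and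
right multiplication by `u` scale every (regular) additive Haar measure of `D_𝔸` by the same
factor: `vol(u Z) = vol(Z u)`. (Both moduli equal `|N_{D/K}(u)|_𝔸`, the regular and coregular
norms of a central simple algebra being equal.) Vignéras defines the module of `x ∈ X^×` as "le
module commun des deux isomorphismes de multiplication à gauche, ou à droite".
[cite: VignerasLNM800, Ch. II §4 Définition (module) and Ch. III §1; WeilBNT1967 Ch. IV §3 (Cor. of Prop. 3) and Ch. IX §2 Prop. 6 Cor. 1] -/
def addHaar_units_smul_eq_op_smul : Prop :=
  ∀ [Algebra.IsCentral K D] [IsSimpleRing D] [Module.Finite K D]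
    (μ : Measure (ScalarExtension K (AdeleRing (𝓞 K) K) D)) [μ.IsAddHaarMeasure] [μ.Regular]
    (u : (ScalarExtension K (AdeleRing (𝓞 K) K) D)ˣ)
    (s : Set (ScalarExtension K (AdeleRing (𝓞 K) K) D)),
    μ (u • s) = μ (MulOpposite.op (u : ScalarExtension K (AdeleRing (𝓞 K) K) D) • s)

/-- **Archimedean module of real scalars**: for `t > 0` embedded diagonally at the infinite places
(`posRealCentral K D t = (t)_{v∣∞} ⊗ 1 ∈ D_𝔸ˣ`), multiplication by `t` scales additive Haar
measure on `D_𝔸 = 𝔸_K ⊗_K D` by `t ^ ([K:ℚ] · dim_K D)`: the module of `t ∈ ℝ` on `K_v` is `|t|`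
for `v` real and `|t|²` for `v` complex (Vignéras II §4: `‖x‖_ℝ = |x|`, `‖x‖_ℂ = |x|²`), the
adelic module is the product of the local ones (Vignéras III §1), the finite components of `t`
are `1`, and `∑_{v∣∞} [K_v:ℝ] = [K:ℚ]`; cf. Weil, BNT IV §4, proof of Thm. 5: `|z(λ)|_A = λⁿ`.
[cite: VignerasLNM800, Ch. II §4 (modules of ℝ, ℂ, H) and Ch. III §1 (‖·‖_A = ∏_v ‖·‖_v); WeilBNT1967 Ch. IV §4 proof of Thm. 5] -/
def addHaar_posRealCentral_smul : Prop :=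
  ∀ [Module.Finite K D]
    (μ : Measure (ScalarExtension K (AdeleRing (𝓞 K) K) D)) [μ.IsAddHaarMeasure] [μ.Regular]
    (t : ℝ≥0ˣ) (s : Set (ScalarExtension K (AdeleRing (𝓞 K) K) D)),
    μ (posRealCentral K D t • s) =
      ((t : ℝ≥0) : ℝ≥0∞) ^ (Module.finrank ℚ K * Module.finrank K D) * μ s

variable [Module.Finite K D] [LocallyCompactSpace (AdeleRing (𝓞 K) K)]

/-- The **left module** `‖u‖ₗ` of an adelic unit `u ∈ D_𝔸ˣ`: the factor by which `x ↦ u x`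
scales additive Haar measure on `D_𝔸` (Mathlib `distribHaarChar` for the left action of `D_𝔸ˣ`;
Vignéras II §4, Weil I §2 / IV §3 "module of the automorphism `x → ux`"). Requires local
compactness of `𝔸_K` (an instance hypothesis, see `locallyCompactSpace_adeleRing`). [folklore] -/
def leftModule : (ScalarExtension K (AdeleRing (𝓞 K) K) D)ˣ →* ℝ≥0 :=
  distribHaarChar (ScalarExtension K (AdeleRing (𝓞 K) K) D)

/-- The **right module** `‖u‖ᵣ` of an adelic unit `u ∈ D_𝔸ˣ`: the factor by which `x ↦ x u`
scales additive Haar measure on `D_𝔸` (`distribHaarChar` for the action of `(D_𝔸ᵐᵒᵖ)ˣ`;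
Weil IV §3 "module of the automorphism `x → xu`"). [folklore] -/
def rightModule (u : (ScalarExtension K (AdeleRing (𝓞 K) K) D)ˣ) : ℝ≥0 :=
  distribHaarChar (ScalarExtension K (AdeleRing (𝓞 K) K) D) (Units.opEquiv.symm (MulOpposite.op u))

/-- `‖u‖ₗ · μ(s) = μ(u • s)` for every regular Haar measure `μ` (Mathlib `distribHaarChar_mul`). [folklore] -/
theorem leftModule_mul_measure (μ : Measure (ScalarExtension K (AdeleRing (𝓞 K) K) D))
    [μ.IsAddHaarMeasure] [μ.Regular] (u : (ScalarExtension K (AdeleRing (𝓞 K) K) D)ˣ)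
    (s : Set (ScalarExtension K (AdeleRing (𝓞 K) K) D)) :
    (leftModule K D u : ℝ≥0∞) * μ s = μ (u • s) :=
  distribHaarChar_mul μ u s

/-- `‖u‖ᵣ · μ(s) = μ(s · u)` for every regular Haar measure `μ` (Mathlib `distribHaarChar_mul`
for the opposite action). [folklore] -/
theorem rightModule_mul_measure (μ : Measure (ScalarExtension K (AdeleRing (𝓞 K) K) D))
    [μ.IsAddHaarMeasure] [μ.Regular] (u : (ScalarExtension K (AdeleRing (𝓞 K) K) D)ˣ)
    (s : Set (ScalarExtension K (AdeleRing (𝓞 K) K) D)) :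
    (rightModule K D u : ℝ≥0∞) * μ s =
      μ (MulOpposite.op (u : ScalarExtension K (AdeleRing (𝓞 K) K) D) • s) := by
  rw [rightModule, distribHaarChar_mul μ]
  rfl

/-- `‖·‖ₗ` is positive. [folklore] -/
theorem leftModule_pos (u : (ScalarExtension K (AdeleRing (𝓞 K) K) D)ˣ) : 0 < leftModule K D u :=
  distribHaarChar_pos

/-- `‖·‖ᵣ` is positive. [folklore] -/
theorem rightModule_pos (u : (ScalarExtension K (AdeleRing (𝓞 K) K) D)ˣ) : 0 < rightModule K D u :=
  distribHaarChar_pos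

/-- Under `addHaar_units_smul_eq_op_smul` (central simple `D`), `‖u‖ᵣ = ‖u‖ₗ`
(Vignéras II §4 "module commun"). [folklore] -/
theorem rightModule_eq_leftModule [Algebra.IsCentral K D] [IsSimpleRing D]
    (h : addHaar_units_smul_eq_op_smul K D) (u : (ScalarExtension K (AdeleRing (𝓞 K) K) D)ˣ) :
    rightModule K D u = leftModule K D u := by
  haveI : T2Space (AdeleRing (𝓞 K) K) := t2Space_adeleRing K
  have hk : Nonempty (TopologicalSpace.PositiveCompacts
      (ScalarExtension K (AdeleRing (𝓞 K) K) D)) := inferInstance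
  obtain ⟨k⟩ := hk
  have h0 : Measure.addHaar (k : Set (ScalarExtension K (AdeleRing (𝓞 K) K) D)) ≠ 0 :=
    (Measure.measure_pos_of_nonempty_interior _ k.interior_nonempty).ne'
  have htop : Measure.addHaar (k : Set (ScalarExtension K (AdeleRing (𝓞 K) K) D)) ≠ ∞ :=
    k.isCompact.measure_lt_top.ne
  have key : Measure.addHaar ((Units.opEquiv.symm (MulOpposite.op u)) •
      (k : Set (ScalarExtension K (AdeleRing (𝓞 K) K) D))) =
      leftModule K D u * Measure.addHaar (k : Set (ScalarExtension K (AdeleRing (𝓞 K) K) D)) := by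
    rw [leftModule_mul_measure K D Measure.addHaar u k, h Measure.addHaar u k]
    rfl
  exact distribHaarChar_eq_of_measure_smul_eq_mul h0 htop key

/-- Under `addHaar_posRealCentral_smul`, the left module of the real scalar `t > 0` is
`t ^ ([K:ℚ] · dim_K D)` (Weil IV §4: `|z(λ)|_A = λⁿ`). [folklore] -/
theorem leftModule_posRealCentral (h : addHaar_posRealCentral_smul K D) (t : ℝ≥0ˣ) :
    leftModule K D (posRealCentral K D t) =
      (t : ℝ≥0) ^ (Module.finrank ℚ K * Module.finrank K D) := by
  haveI : T2Space (AdeleRing (𝓞 K) K) := t2Space_adeleRing K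
  have hk : Nonempty (TopologicalSpace.PositiveCompacts
      (ScalarExtension K (AdeleRing (𝓞 K) K) D)) := inferInstance
  obtain ⟨k⟩ := hk
  have h0 : Measure.addHaar (k : Set (ScalarExtension K (AdeleRing (𝓞 K) K) D)) ≠ 0 :=
    (Measure.measure_pos_of_nonempty_interior _ k.interior_nonempty).ne'
  have htop : Measure.addHaar (k : Set (ScalarExtension K (AdeleRing (𝓞 K) K) D)) ≠ ∞ :=
    k.isCompact.measure_lt_top.ne
  refine distribHaarChar_eq_of_measure_smul_eq_mul h0 htop ?_
  rw [h Measure.addHaar t k, ENNReal.coe_pow]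

/-- Every adelic unit can be rescaled by a positive real scalar to have left module `1`
(granted `addHaar_posRealCentral_smul` and `dim_K D ≠ 0`): the module of `ℝ_{>0}` is onto
(Vignéras III §1 Exercice 1.1; Weil IV §4 Cor. 2 of Thm. 5 for `k`). [folklore] -/
theorem exists_leftModule_mul_posRealCentral_eq_one (h : addHaar_posRealCentral_smul K D)
    (hD : Module.finrank K D ≠ 0) (x : (ScalarExtension K (AdeleRing (𝓞 K) K) D)ˣ) :
    ∃ t : ℝ≥0ˣ, leftModule K D (x * posRealCentral K D t) = 1 := by
  set N : ℕ := Module.finrank ℚ K * Module.finrank K D with hN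
  have hN0 : N ≠ 0 := mul_ne_zero Module.finrank_pos.ne' hD
  set δ : ℝ≥0 := leftModule K D x with hδ
  have hδ0 : δ ≠ 0 := (leftModule_pos K D x).ne'
  have hs0 : δ ^ (-(1 / (N : ℝ))) ≠ 0 := by
    rw [Ne, NNReal.rpow_eq_zero_iff]
    exact fun hh => hδ0 hh.1
  refine ⟨Units.mk0 (δ ^ (-(1 / (N : ℝ)))) hs0, ?_⟩
  rw [map_mul, leftModule_posRealCentral K D h, Units.val_mk0, ← hδ, ← NNReal.rpow_natCast,
    ← NNReal.rpow_mul]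
  have : -(1 / (N : ℝ)) * (N : ℝ) = -1 := by
    have : (N : ℝ) ≠ 0 := Nat.cast_ne_zero.2 hN0
    field_simp
  rw [this, NNReal.rpow_neg_one, mul_inv_cancel₀ hδ0]

end Modules

/-! ### Fujisaki's lemma (Weil, BNT Thm. IV.4; Vignéras III §1 Thm. 1.4, Idèles 3) -/

section Fujisaki

variable (K : Type) [Field K] [NumberField K] (D : Type u) [Ring D] [Algebra K D]
  [Module.Finite K D]

/-- If `D` is a division ring then `incl : D → D_𝔸` is injective (a non-zero `d` is a unit, hence
so is `1 ⊗ d`, and `D_𝔸 ≠ 0`). [folklore] -/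
theorem incl_injective_of_isUnit [Nontrivial D] (hdiv : ∀ x : D, x ≠ 0 → IsUnit x) :
    Function.Injective (ScalarExtension.incl K (AdeleRing (𝓞 K) K) D) := by
  -- `D_𝔸 ≅ 𝔸^n` with `n ≥ 1` is non-trivial
  haveI : Nontrivial (ScalarExtension K (AdeleRing (𝓞 K) K) D) := by
    have hn : 0 < Module.finrank K D := Module.finrank_pos
    haveI : Nonempty (Fin (Module.finrank K D)) := ⟨⟨0, hn⟩⟩
    haveI : Nontrivial (AdeleRing (𝓞 K) K) :=
      inferInstanceAs (Nontrivial (InfiniteAdeleRing K × FiniteAdeleRing (𝓞 K) K))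
    exact (ScalarExtension.coordLinearEquiv K (AdeleRing (𝓞 K) K) D).symm.injective.nontrivial
  intro a b hab
  by_contra hne
  have hu : IsUnit (ScalarExtension.incl K (AdeleRing (𝓞 K) K) D (a - b)) :=
    (hdiv _ (sub_ne_zero.2 hne)).map _
  rw [map_sub, hab, sub_self] at hu
  exact not_isUnit_zero hu

/-- `D_𝔸` is not compact when `D ≠ 0` is a division ring and `D` is discrete in `D_𝔸`: the
lattice `D` is infinite, closed and discrete. [folklore] -/
theorem noncompactSpace_scalarExtension [Nontrivial D] (hdiv : ∀ x : D, x ≠ 0 → IsUnit x)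
    (hdisc : DiscreteTopology (rationalLattice K D)) :
    NoncompactSpace (ScalarExtension K (AdeleRing (𝓞 K) K) D) := by
  haveI : T2Space (AdeleRing (𝓞 K) K) := t2Space_adeleRing K
  refine ⟨fun hc => ?_⟩
  have hclosed : IsClosed (rationalLattice K D : Set (ScalarExtension K (AdeleRing (𝓞 K) K) D)) :=
    AddSubgroup.isClosed_of_discrete
  -- the lattice is compact, closed and discrete, hence finite
  have hfin : (Set.univ : Set (rationalLattice K D)).Finite :=
    (hclosed.isClosedEmbedding_subtypeVal.isCompact_preimage hc).finite_of_discrete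
  haveI : Finite (rationalLattice K D) := Set.finite_univ_iff.1 hfin
  -- but `D` is infinite and injects into it
  haveI : Infinite D :=
    Infinite.of_injective _ ((algebraMap K D).injective.comp
      (Nat.cast_injective (R := K)))
  have hinj : Function.Injective (fun d : D => (⟨_, incl_mem_rationalLattice K D d⟩ :
      rationalLattice K D)) := fun a b hab =>
    incl_injective_of_isUnit K D hdiv (congrArg Subtype.val hab)
  haveI : Finite D := Finite.of_injective _ hinj
  exact not_finite D

omit [Module.Finite K D] in
/-- `↑(inclAdelic K D d) = incl d` (definitional). [folklore] -/
@[simp]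
theorem coe_inclAdelic (d : Dˣ) :
    (inclAdelic K D d : ScalarExtension K (AdeleRing (𝓞 K) K) D) =
      ScalarExtension.incl K (AdeleRing (𝓞 K) K) D d := rfl

omit [Module.Finite K D] in
/-- A number field is countable. [folklore] -/
theorem countable_numberField (F : Type*) [Field F] [NumberField F] : Countable F :=
  Countable.of_equiv _ (Module.finBasis ℚ F).equivFun.toEquiv.symm

include K in
/-- A finite-dimensional algebra over a number field is countable. [folklore] -/
theorem countable_of_module_finite : Countable D := by
  haveI := countable_numberField K
  exact Countable.of_equiv _ (Module.finBasis K D).equivFun.toEquiv.symm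

/-- The lattice `D ⊆ D_𝔸` is countable. [folklore] -/
instance countable_rationalLattice : Countable (rationalLattice K D) := by
  haveI := countable_of_module_finite K D
  exact (AddMonoidHom.rangeRestrict_surjective _).countable

variable [LocallyCompactSpace (AdeleRing (𝓞 K) K)]

/-- **Fujisaki's lemma in Weil's form (BNT Thm. IV.4)**, for a finite-dimensional *division*
algebra `D` over a number field `K`, granted that `D` is discrete and cocompact in `D_𝔸`
(Weil Thm. IV.2) and that `𝔸_K` is locally compact: for every `m > 0` there is a compact subset
`Y ⊆ D_𝔸ˣ` such that every adelic unit `x` whose left module is `≤ m` and whose right module is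
`≥ m⁻¹` satisfies `x δ ∈ Y` for some `δ ∈ Dˣ`; i.e. the image of
`D_m = {x : ‖x‖ₗ ≤ m, ‖x‖ᵣ ≥ m⁻¹}` in `D_𝔸ˣ / Dˣ` is contained in the image of the compact set `Y`.
The proof is Weil's (the "Minkowski argument" `exists_ne_sub_mem_of_measure_lt` applied to
`x⁻¹ C` and `C x` for a compact `C` of measure `> m · vol(B)`, `B` a compact set covering
`D_𝔸 / D`, and finiteness of `Dˣ ∩ C''`). Vignéras III §1 Thm. 1.4, Idèles 3).
[cite: WeilBNT1967, Ch. IV §3 Thm. 4 (p. 74, proof due to Fujisaki); VignerasLNM800 Ch. III §1 Thm. 1.4 (Idèles 3)] -/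
theorem exists_isCompact_mul_inclAdelic_mem [Nontrivial D] (hdiv : ∀ x : D, x ≠ 0 → IsUnit x)
    (hdisc : DiscreteTopology (rationalLattice K D))
    (hcpt : CompactSpace (ScalarExtension K (AdeleRing (𝓞 K) K) D ⧸ rationalLattice K D))
    (m : ℝ≥0) (hm : m ≠ 0) :
    ∃ Y : Set (ScalarExtension K (AdeleRing (𝓞 K) K) D)ˣ, IsCompact Y ∧
      ∀ x : (ScalarExtension K (AdeleRing (𝓞 K) K) D)ˣ, leftModule K D x ≤ m →
        m⁻¹ ≤ rightModule K D x → ∃ d : Dˣ, x * inclAdelic K D d ∈ Y := by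
  haveI : T2Space (AdeleRing (𝓞 K) K) := t2Space_adeleRing K
  haveI := noncompactSpace_scalarExtension K D hdiv hdisc
  have hclosed : IsClosed
      (rationalLattice K D : Set (ScalarExtension K (AdeleRing (𝓞 K) K) D)) :=
    AddSubgroup.isClosed_of_discrete
  -- a compact set `B` covering `D_𝔸 / D`
  obtain ⟨B, hB, hBcov⟩ := exists_isCompact_image_mk_eq_univ (rationalLattice K D)
  have hcov : ∀ x : ScalarExtension K (AdeleRing (𝓞 K) K) D,
      ∃ g ∈ rationalLattice K D, g + x ∈ B := by
    intro x
    obtain ⟨b, hb, hbx⟩ : ∃ b ∈ B, (QuotientAddGroup.mk b :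
        ScalarExtension K (AdeleRing (𝓞 K) K) D ⧸ rationalLattice K D) = QuotientAddGroup.mk x := by
      have : (QuotientAddGroup.mk x : _ ⧸ rationalLattice K D) ∈ QuotientAddGroup.mk '' B := by
        rw [hBcov]; exact Set.mem_univ _
      simpa only [Set.mem_image] using this
    refine ⟨-(-b + x), neg_mem (QuotientAddGroup.eq.1 hbx), ?_⟩
    have : -(-b + x) + x = b := by abel
    rwa [this]
  -- Haar measure and a large compact set `C`
  set μ : Measure (ScalarExtension K (AdeleRing (𝓞 K) K) D) := Measure.addHaar with hμ
  have hBtop : μ B < ∞ := hB.measure_lt_top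
  have huniv : μ Set.univ = ∞ := measure_univ_of_isAddLeftInvariant μ
  obtain ⟨C, -, hC, hmC⟩ := isOpen_univ.exists_lt_isCompact (μ := μ)
    (r := (m : ℝ≥0∞) * μ B) (by rw [huniv]; exact ENNReal.mul_lt_top ENNReal.coe_lt_top hBtop)
  have key : ∀ δ : ℝ≥0, m⁻¹ ≤ δ → μ B < (δ : ℝ≥0∞) * μ C := fun δ hδ =>
    calc μ B = (m : ℝ≥0∞)⁻¹ * ((m : ℝ≥0∞) * μ B) := by
          rw [← mul_assoc, ENNReal.inv_mul_cancel (by exact_mod_cast hm) ENNReal.coe_ne_top,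
            one_mul]
      _ < (m : ℝ≥0∞)⁻¹ * μ C :=
          ENNReal.mul_lt_mul_right (ENNReal.inv_ne_zero.2 ENNReal.coe_ne_top)
            (ENNReal.inv_ne_top.2 (by exact_mod_cast hm)) hmC
      _ ≤ (δ : ℝ≥0∞) * μ C := by
          gcongr
          rw [← ENNReal.coe_inv hm]
          exact_mod_cast hδ
  -- `C' = C - C`, `C'' = C' * C'`
  set C' : Set (ScalarExtension K (AdeleRing (𝓞 K) K) D) :=
    (fun p : _ × _ => p.1 - p.2) '' C ×ˢ C with hC'
  have hC'c : IsCompact C' := (hC.prod hC).image (continuous_fst.sub continuous_snd)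
  have hmemC' : ∀ c₁ ∈ C, ∀ c₂ ∈ C, c₁ - c₂ ∈ C' := fun c₁ h₁ c₂ h₂ =>
    ⟨(c₁, c₂), Set.mk_mem_prod h₁ h₂, rfl⟩
  set C'' : Set (ScalarExtension K (AdeleRing (𝓞 K) K) D) :=
    (fun p : _ × _ => p.1 * p.2) '' C' ×ˢ C' with hC''
  have hC''c : IsCompact C'' := (hC'c.prod hC'c).image (continuous_fst.mul continuous_snd)
  have hmemC'' : ∀ c₁ ∈ C', ∀ c₂ ∈ C', c₁ * c₂ ∈ C'' := fun c₁ h₁ c₂ h₂ =>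
    ⟨(c₁, c₂), Set.mk_mem_prod h₁ h₂, rfl⟩
  -- the finite set `Φ = {δ ∈ Dˣ : incl δ ∈ C''}`
  set Φ : Set Dˣ := {d | (inclAdelic K D d : ScalarExtension K (AdeleRing (𝓞 K) K) D) ∈ C''}
    with hΦ
  have hΦf : Φ.Finite := by
    have h1 : ((Subtype.val : rationalLattice K D → _) ⁻¹' C'').Finite :=
      (hclosed.isClosedEmbedding_subtypeVal.isCompact_preimage hC''c).finite_of_discrete
    refine Set.Finite.of_finite_image (f := fun d : Dˣ =>
      (⟨_, incl_mem_rationalLattice K D (d : D)⟩ : rationalLattice K D)) (h1.subset ?_) ?_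
    · rintro _ ⟨d, hd, rfl⟩
      exact hd
    · intro a _ b _ hab
      exact Units.ext (incl_injective_of_isUnit K D hdiv (congrArg Subtype.val hab))
  -- the compact set `Y = {y : y ∈ C', y⁻¹ ∈ ⋃_{δ ∈ Φ} δ⁻¹ C'}`
  set C₃ : Set (ScalarExtension K (AdeleRing (𝓞 K) K) D) :=
    ⋃ d ∈ Φ, ((inclAdelic K D d)⁻¹ : (ScalarExtension K (AdeleRing (𝓞 K) K) D)ˣ) • C' with hC₃
  have hC₃c : IsCompact C₃ := hΦf.isCompact_biUnion fun d _ => hC'c.smul _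
  set Y : Set (ScalarExtension K (AdeleRing (𝓞 K) K) D)ˣ :=
    Units.embedProduct _ ⁻¹' (C' ×ˢ (MulOpposite.op '' C₃)) with hY
  have hYc : IsCompact Y :=
    Units.isClosedEmbedding_embedProduct.isCompact_preimage
      (hC'c.prod (hC₃c.image MulOpposite.continuous_op))
  refine ⟨Y, hYc, fun x hxl hxr => ?_⟩
  -- (a) Minkowski argument for `x⁻¹ C`
  have hS₁ : μ B < μ (x⁻¹ • C) := by
    rw [← leftModule_mul_measure K D μ, map_inv]
    exact key _ ((inv_le_inv₀ (pos_of_ne_zero hm) (leftModule_pos K D x)).2 hxl)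
  obtain ⟨_, ha, _, hb, hab, habL⟩ := exists_ne_sub_mem_of_measure_lt μ (rationalLattice K D)
    hB.measurableSet hcov (hC.smul _).measurableSet hS₁
  obtain ⟨c₁, hc₁, rfl⟩ := Set.mem_smul_set.1 ha
  obtain ⟨c₂, hc₂, rfl⟩ := Set.mem_smul_set.1 hb
  obtain ⟨d₂, hd₂⟩ := (mem_rationalLattice_iff K D).1 habL
  have hd₂0 : d₂ ≠ 0 := by
    rintro rfl
    rw [map_zero, eq_comm, sub_eq_zero] at hd₂
    exact hab hd₂
  obtain ⟨δ₂, rfl⟩ := hdiv d₂ hd₂0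
  have eq₂ : (x : ScalarExtension K (AdeleRing (𝓞 K) K) D) * inclAdelic K D δ₂ = c₁ - c₂ := by
    rw [coe_inclAdelic, hd₂]
    change (x : ScalarExtension K (AdeleRing (𝓞 K) K) D) * ((↑x⁻¹ : _) * c₁ - (↑x⁻¹ : _) * c₂) = _
    rw [← mul_sub, Units.mul_inv_cancel_left]
  -- (b) Minkowski argument for `C x`
  have hS₂ : μ B < μ (MulOpposite.op (x : ScalarExtension K (AdeleRing (𝓞 K) K) D) • C) := by
    rw [← rightModule_mul_measure K D μ]
    exact key _ hxr
  obtain ⟨_, ha', _, hb', hab', habL'⟩ := exists_ne_sub_mem_of_measure_lt μ (rationalLattice K D)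
    hB.measurableSet hcov (hC.smul _).measurableSet hS₂
  obtain ⟨c₃, hc₃, rfl⟩ := Set.mem_smul_set.1 ha'
  obtain ⟨c₄, hc₄, rfl⟩ := Set.mem_smul_set.1 hb'
  obtain ⟨d₁, hd₁⟩ := (mem_rationalLattice_iff K D).1 habL'
  have hd₁0 : d₁ ≠ 0 := by
    rintro rfl
    rw [map_zero, eq_comm, sub_eq_zero] at hd₁
    exact hab' hd₁
  obtain ⟨δ₁, rfl⟩ := hdiv d₁ hd₁0
  have eq₁ : (inclAdelic K D δ₁ : ScalarExtension K (AdeleRing (𝓞 K) K) D) = (c₃ - c₄) * x := by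
    rw [coe_inclAdelic, hd₁]
    change (c₃ * (x : ScalarExtension K (AdeleRing (𝓞 K) K) D)) - c₄ * x = _
    rw [sub_mul]
  -- (c) `δ₁ δ₂ ∈ Φ`
  have hΦmem : δ₁ * δ₂ ∈ Φ := by
    change ((inclAdelic K D (δ₁ * δ₂) : (ScalarExtension K (AdeleRing (𝓞 K) K) D)ˣ) :
      ScalarExtension K (AdeleRing (𝓞 K) K) D) ∈ C''
    rw [map_mul, Units.val_mul, eq₁, mul_assoc, eq₂]
    exact hmemC'' _ (hmemC' _ hc₃ _ hc₄) _ (hmemC' _ hc₁ _ hc₂)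
  -- (d) `y = x δ₂ ∈ Y`
  refine ⟨δ₂, ?_⟩
  simp only [hY, Set.mem_preimage, Units.embedProduct_apply, Set.mem_prod, Units.val_mul]
  refine ⟨eq₂ ▸ hmemC' _ hc₁ _ hc₂, Set.mem_image_of_mem _ ?_⟩
  refine Set.mem_iUnion₂.2 ⟨δ₁ * δ₂, hΦmem, Set.mem_smul_set.2 ⟨c₃ - c₄, hmemC' _ hc₃ _ hc₄, ?_⟩⟩
  have e₁ : c₃ - c₄ = (inclAdelic K D δ₁ : ScalarExtension K (AdeleRing (𝓞 K) K) D) * ↑x⁻¹ :=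
    (Units.eq_mul_inv_iff_mul_eq x).2 eq₁.symm
  change ((inclAdelic K D (δ₁ * δ₂))⁻¹ : (ScalarExtension K (AdeleRing (𝓞 K) K) D)ˣ) •
    (c₃ - c₄) = _
  rw [e₁, Units.smul_def, smul_eq_mul, map_mul, mul_inv_rev, Units.val_mul, mul_assoc,
    Units.inv_mul_cancel_left, mul_inv_rev, Units.val_mul]

end Fujisaki

/-! ### The automorphic quotient of `D^×` -/

section Reduction

variable (K : Type) [Field K] [NumberField K] (D : Type u) [Ring D] [Algebra K D]

/-- **Fujisaki's compactness theorem, reduced to its classical inputs.** For a division quaternion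
algebra `D` over a number field `K`, the automorphic quotient `(D ⊗ 𝔸_K)ˣ ⧸ (ℝ_{>0} · Dˣ)` is
compact, *granted*: compactness of the local integer rings `𝒪_v` (local compactness of `𝔸_K`),
Weil's Thm. IV.2 for `D` (discreteness and cocompactness of `D` in `D_𝔸`), equality of left and
right modules on `D_𝔸ˣ` (Vignéras II §4), and the archimedean module formula for `ℝ_{>0}`.
Proof: rescale `x ∈ D_𝔸ˣ` by `t ∈ ℝ_{>0}` to module `1` (`exists_leftModule_mul_posRealCentral_eq_one`),
apply Fujisaki's lemma `exists_isCompact_mul_inclAdelic_mem` with `m = 1`, and conclude that the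
quotient is the continuous image of a compact set (Vignéras III §1 Thm. 1.4 (3) with Exercice 1.1;
Weil IV §3 Thm. 4). [cite: VignerasLNM800, Ch. III §1 Thm. 1.4 (Idèles 3, Fujisaki) and Exercice 1.1] -/
theorem AdelicGroupData.compactSpace_automorphicQuotient_units_of
    (hO : compactSpace_adicCompletionIntegers K)
    (hdisc : discreteTopology_rationalLattice K D)
    (hcpt : compactSpace_quotient_rationalLattice K D)
    (hmod : addHaar_units_smul_eq_op_smul K D)
    (harch : addHaar_posRealCentral_smul K D) :
    AdelicGroupData.compactSpace_automorphicQuotient_units K D := by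
  intro hQ hdiv
  haveI : LocallyCompactSpace (AdeleRing (𝓞 K) K) := QuaternionAlgebraAdelicProofs.locallyCompactSpace_adeleRing K hO
  haveI : IsSimpleRing D := IsQuaternionAlgebra.isSimpleRing' K D
  have h4 : Module.finrank K D = 4 := IsQuaternionAlgebra.finrank_eq_four (K := K) (D := D)
  haveI : Nontrivial D := Module.nontrivial_of_finrank_pos (R := K) (by omega)
  obtain ⟨Y, hYc, hY⟩ := exists_isCompact_mul_inclAdelic_mem K D hdiv hdisc hcpt 1 one_ne_zero
  -- every coset meets `Y`
  have hcov : ∀ x : adelicUnits K D, ∃ h : adelicUnits K D,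
      h ∈ (AdelicGroupData.units K D).quotientSubgroup ∧ x * h ∈ Y := by
    intro x
    obtain ⟨t, ht⟩ := exists_leftModule_mul_posRealCentral_eq_one K D harch (by omega) x
    have hr : (1 : ℝ≥0)⁻¹ ≤ rightModule K D (x * posRealCentral K D t) := by
      rw [inv_one, rightModule_eq_leftModule K D hmod, ht]
    obtain ⟨d, hd⟩ := hY _ ht.le hr
    refine ⟨posRealCentral K D t * inclAdelic K D d, ?_, by simpa only [mul_assoc] using hd⟩
    exact Subgroup.mul_mem_sup ⟨t, rfl⟩ ⟨d, rfl⟩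
  -- hence the quotient is the image of `Y`
  refine ⟨?_⟩
  have : (Set.univ : Set (AdelicGroupData.units K D).automorphicQuotient) =
      (AdelicGroupData.units K D).toAutomorphicQuotient '' Y := by
    refine (Set.eq_univ_of_forall fun q => ?_).symm
    obtain ⟨x, rfl⟩ := QuotientGroup.mk_surjective q
    obtain ⟨h, hh, hxh⟩ := hcov x
    exact ⟨_, hxh, QuotientGroup.mk_mul_of_mem x hh⟩
  rw [this]
  exact hYc.image (AdelicGroupData.continuous_toAutomorphicQuotient _)

end Reduction

end Literature.NumberTheory.Automorphic
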